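import Summits.CriticalPhenomena.PercolationContinuityZ3.Theorems.PercNearOneGluingNoHeavyLowerTailSunflowerRestrictionTwoPetal
import Summits.CriticalPhenomena.PercolationContinuityZ3.Theorems.PercNearOneGluingNoHeavyLowerTailSunflowerSpectatorRows
import HarnessLib

/-!
# `NoHeavyLowerTail` (crux stmt-CriticalPhenomena-4575), abstract sunflower cubic: RESTRICTION MONOTONICITY (MZ) holds at every
# coordinate that creates NO LIFTED RAINBOW

Support file (seat `prim-l12-p2` gen 8; `--supports stmt-CriticalPhenomena-4575`; companion of `…SunflowerRestrictionTwoPetal` (p225252),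
`…SunflowerRestrictionSingleton` (p222183), `…SunflowerSpectatorRows` (p219831)).  Memo: run/shared/lean/prim/prim-l12/prim-l12-p2/FINDING-g8-MZ-PETAL-FREE.md.
Nothing is asserted about the crux; no `sorry`.

SETTING.  `F : Sunflower α`, a sub-cube `2^W`, `e ∉ W`, the lower/upper sections `φ = lab`, `ψX = lab (insert e X)` on `2^W`, and the nested
partition sum `nested W (s6H ∘ lab) = F.ZP W ∅ ∅ ∅`.  A LIFTED RAINBOW at `e` is an ordered 3-partition `(X, S, T)` of `W` with
`ψX, φS, φT` three pairwise distinct petals (`triP (lab (insert e X)) (lab S) (lab T) = 1`).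

MAIN RESULT (this work; the general form behind p225252 and the remark of seat `prim-ineq-prove-1`, FINDING-LIFTCONE §5(2)):
**if the coordinate `e` creates no lifted rainbow on `2^W`, then (MZ) holds at `e`:** `F.ZP W ∅ ∅ ∅ ≤ F.ZP (insert e W) ∅ ∅ ∅`
(`Sunflower.ZP_le_ZP_insert_of_no_lifted_rainbow`).  Proof: by the spectator form `s6H = Σ_spectators kk − triP` (`s6H_eq_spec`), the unlifted sum is
`3·N₀ − Ntri(φ,φ,φ) ≤ 3·N₀` (`triP ≥ 0`) and the lifted sum is `N₁ + 2·N₂` exactly (no lifted rainbows), where `N₀, N₁, N₂` are the spectator-Gladkov sums of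
`…RestrictionTwoPetal`; and `N₀ ≤ N₁ + 2N₂` is `Sunflower.spectator_core_le` (antipodal Gladkov `0 ≤ σ₀₀, σ₁₀, σ₁₁` plus the summed exchange `σ₀₀ + σ₁₁ ≤ 2σ₁₀`).
COROLLARIES: (MZ) at `e` whenever the lower section on `2^W` uses at most ONE petal value (`…_of_lower_le_one_petal`, the upper section being arbitrary),
and — already in p225252 — whenever some petal value is missing on `2^(insert e W)`.  So the entire content of the conjecture `RestrictionMonotonicity` is
the payment of the lifted rainbows `3·Ntri(ψ,φ,φ)`.
-/

namespace Summit.CriticalPhenomena.PercolationContinuityZ3.Theorems.SunflowerPartition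

open Finset

/-- `triP x y z = 0` unless `y` and `z` are two distinct petals (so: no rainbow with at most one petal among the last two entries). [this work] -/
theorem triP_eq_zero_of_mem : ∀ k x y z : Fin 5, (y = 0 ∨ y = k ∨ y = 4) → (z = 0 ∨ z = k ∨ z = 4) → triP x y z = 0 := by decide

variable {α : Type*} [DecidableEq α]

/-- **Restriction monotonicity without lifted rainbows, nested form** (this work): if no ordered 3-partition `(X,S,T)` of `W` has
`lab (insert e X), lab S, lab T` three distinct petals, then `nested W (s6H ∘ lab) ≤ nested (insert e W) (s6H ∘ lab)` (`e ∉ W`). -/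
theorem Sunflower.nested_le_nested_insert_of_no_lifted_rainbow (F : Sunflower α) (W : Finset α) (e : α) (he : e ∉ W)
    (hnr : ∀ X ∈ W.powerset, ∀ S ∈ (W \ X).powerset, triP (F.lab (insert e X)) (F.lab S) (F.lab ((W \ X) \ S)) = 0) :
    nested W (fun X S T => s6H (F.lab X) (F.lab S) (F.lab T))
      ≤ nested (insert e W) (fun X S T => s6H (F.lab X) (F.lab S) (F.lab T)) := by
  rw [F.nested_insert_eq W e he]
  -- unlifted sum: spectator form minus the (nonnegative) rainbow count
  have hT0 : nested W (fun X S T => s6H (F.lab X) (F.lab S) (F.lab T))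
      ≤ 3 * nested W (fun X S T => (if F.lab X = 0 ∨ F.lab X = 4 then (1 : ℤ) else 0) * kk (F.lab S) (F.lab T)) := by
    have step : nested W (fun X S T => s6H (F.lab X) (F.lab S) (F.lab T))
        = nested W (fun X S T => (if F.lab X = 0 ∨ F.lab X = 4 then (1 : ℤ) else 0) * kk (F.lab S) (F.lab T))
          + nested W (fun X S T => (if F.lab S = 0 ∨ F.lab S = 4 then (1 : ℤ) else 0) * kk (F.lab X) (F.lab T))
          + nested W (fun X S T => (if F.lab T = 0 ∨ F.lab T = 4 then (1 : ℤ) else 0) * kk (F.lab X) (F.lab S))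
          - nested W (fun X S T => triP (F.lab X) (F.lab S) (F.lab T)) := by
      unfold nested
      rw [← sum_add_distrib, ← sum_add_distrib, ← sum_sub_distrib]
      refine sum_congr rfl fun X _ => ?_
      rw [← sum_add_distrib, ← sum_add_distrib, ← sum_sub_distrib]
      refine sum_congr rfl fun S _ => ?_
      exact s6H_eq_spec _ _ _
    have e2 : nested W (fun X S T => (if F.lab S = 0 ∨ F.lab S = 4 then (1 : ℤ) else 0) * kk (F.lab X) (F.lab T))
        = nested W (fun X S T => (if F.lab X = 0 ∨ F.lab X = 4 then (1 : ℤ) else 0) * kk (F.lab S) (F.lab T)) := by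
      rw [nested_swap12]
    have e3 : nested W (fun X S T => (if F.lab T = 0 ∨ F.lab T = 4 then (1 : ℤ) else 0) * kk (F.lab X) (F.lab S))
        = nested W (fun X S T => (if F.lab X = 0 ∨ F.lab X = 4 then (1 : ℤ) else 0) * kk (F.lab S) (F.lab T)) := by
      rw [nested_swap23, nested_swap12]
    have htri : 0 ≤ nested W (fun X S T => triP (F.lab X) (F.lab S) (F.lab T)) := by
      unfold nested
      exact sum_nonneg fun X _ => sum_nonneg fun S _ => triP_nonneg _ _ _
    rw [step, e2, e3]
    linarith
  -- lifted sum: spectator form exactly (no lifted rainbows)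
  have hT1 : nested W (fun X S T => s6H (F.lab (insert e X)) (F.lab S) (F.lab T))
      = nested W (fun X S T => (if F.lab (insert e X) = 0 ∨ F.lab (insert e X) = 4 then (1 : ℤ) else 0) * kk (F.lab S) (F.lab T))
        + 2 * nested W (fun X S T => (if F.lab X = 0 ∨ F.lab X = 4 then (1 : ℤ) else 0) * kk (F.lab (insert e S)) (F.lab T)) := by
    have step : nested W (fun X S T => s6H (F.lab (insert e X)) (F.lab S) (F.lab T))
        = nested W (fun X S T => (if F.lab (insert e X) = 0 ∨ F.lab (insert e X) = 4 then (1 : ℤ) else 0) * kk (F.lab S) (F.lab T))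
          + nested W (fun X S T => (if F.lab S = 0 ∨ F.lab S = 4 then (1 : ℤ) else 0) * kk (F.lab (insert e X)) (F.lab T))
          + nested W (fun X S T => (if F.lab T = 0 ∨ F.lab T = 4 then (1 : ℤ) else 0) * kk (F.lab (insert e X)) (F.lab S)) := by
      unfold nested
      rw [← sum_add_distrib, ← sum_add_distrib]
      refine sum_congr rfl fun X hX => ?_
      rw [← sum_add_distrib, ← sum_add_distrib]
      refine sum_congr rfl fun S hS => ?_
      have h := s6H_eq_spec (F.lab (insert e X)) (F.lab S) (F.lab ((W \ X) \ S))
      rw [hnr X hX S hS, sub_zero] at h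
      exact h
    have e5 : nested W (fun X S T => (if F.lab T = 0 ∨ F.lab T = 4 then (1 : ℤ) else 0) * kk (F.lab (insert e X)) (F.lab S))
        = nested W (fun X S T => (if F.lab S = 0 ∨ F.lab S = 4 then (1 : ℤ) else 0) * kk (F.lab (insert e X)) (F.lab T)) := by
      rw [nested_swap23]
    have e6 : nested W (fun X S T => (if F.lab S = 0 ∨ F.lab S = 4 then (1 : ℤ) else 0) * kk (F.lab (insert e X)) (F.lab T))
        = nested W (fun X S T => (if F.lab X = 0 ∨ F.lab X = 4 then (1 : ℤ) else 0) * kk (F.lab (insert e S)) (F.lab T)) := by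
      rw [nested_swap12]
    rw [step, e5, e6]
    ring
  have hC := F.spectator_core_le W e
  rw [hT1]
  linarith

/-- **(MZ) at a coordinate creating no lifted rainbow, `RestrictionMonotonicity` format** (this work). -/
theorem Sunflower.ZP_le_ZP_insert_of_no_lifted_rainbow (F : Sunflower α) (W : Finset α) (e : α) (he : e ∉ W)
    (hnr : ∀ X ∈ W.powerset, ∀ S ∈ (W \ X).powerset, triP (F.lab (insert e X)) (F.lab S) (F.lab ((W \ X) \ S)) = 0) :
    F.ZP W ∅ ∅ ∅ ≤ F.ZP (insert e W) ∅ ∅ ∅ := by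
  rw [F.ZP_empty_eq_nested, F.ZP_empty_eq_nested]
  exact F.nested_le_nested_insert_of_no_lifted_rainbow W e he hnr

/-- **(MZ) when the lower section uses at most one petal** (this work): if every subset of `W` has label in `{0, k, ⊤}` for one fixed value `k`
(the upper section `X ↦ lab (insert e X)` being arbitrary), then `F.ZP W ∅ ∅ ∅ ≤ F.ZP (insert e W) ∅ ∅ ∅` (`e ∉ W`). -/
theorem Sunflower.ZP_le_ZP_insert_of_lower_le_one_petal (F : Sunflower α) (W : Finset α) (e : α) (he : e ∉ W) (k : Fin 5)
    (hone : ∀ S, S ⊆ W → (F.lab S = 0 ∨ F.lab S = k ∨ F.lab S = 4)) :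
    F.ZP W ∅ ∅ ∅ ≤ F.ZP (insert e W) ∅ ∅ ∅ := by
  refine F.ZP_le_ZP_insert_of_no_lifted_rainbow W e he fun X _ S hS => ?_
  have hS' : S ⊆ W := (mem_powerset.1 hS).trans sdiff_subset
  have hT' : (W \ X) \ S ⊆ W := sdiff_subset.trans sdiff_subset
  exact triP_eq_zero_of_mem k _ _ _ (hone _ hS') (hone _ hT')

end Summit.CriticalPhenomena.PercolationContinuityZ3.Theorems.SunflowerPartition
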